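import Summits.ValiantsHypothesis.ValiantsHypothesis.Theorems.KPlusLogSqLawTridiagonalRealStaticFiveGeography
import Summits.ValiantsHypothesis.ValiantsHypothesis.Theorems.KPlusLogSqLawTridiagonalRealStaticPotentialSteps

/-!
# Route «KPlusLogSqLaw», crux `WeakLifting` (stmt-ValiantsHypothesis-19561) — REAL side of the tridiagonal sector:
# the EDGE-MONOTONE `5 × 5` LAW — at most TWO positive determinant zeros when the normalised link rates satisfy `0 ≤ σ₂ ≤ σ₁`, `0 ≤ σ₃ ≤ σ₄`

HONEST FRAMING.  Helper theorems (`--supports stmt-ValiantsHypothesis-19561 --as helper`), seat val-sym-lift-p3 (g11), cell `pub-symmetroid`,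
2026-08-28; Part 3 of the `m = 5` arena (Part 1 `…TridiagonalRealStaticOverlap` p590486, Part 2 `…TridiagonalRealStaticFiveGeography`
p594929).  A COUNT LAW ON A SUB-SECTOR ONLY: `B 5 ∈ [5, 7]` (kernel) for general designs is unchanged and the located value `B 5 = 5` is not
claimed.  In the normalised link weights `U_i = β_i x^{σ_i}` of the memos (`σ₁ = 2f₀ − d₀ − d₁`, `σ₂ = 2f₁ − d₁ − d₂`, `σ₃ = 2f₂ − d₂ − d₃`,
`σ₄ = 2f₃ − d₃ − d₄`) the hypotheses below read `0 < σ₁`, `0 ≤ σ₂ ≤ σ₁`, `0 ≤ σ₃ ≤ σ₄`, `0 < σ₄` («edge-monotone» designs: every normalised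
link weight is non-decreasing in `x` and the two outer rates dominate the two inner ones).  On this sector the Schur form
`Φ = U₂/(1 − U₁) + U₃/(1 − U₄)` is STRICTLY INCREASING on each of the (at most three) intervals cut out by its two poles (the positive zeros of
the end `2 × 2` minors `D₂`, `Δ`), by a purely algebraic comparison (no calculus); with Part 2's geography (zeros solve `Φ = 1` off the poles,
the pole law, the empty «both end minors negative» region) this gives **at most TWO positive determinant zeros** — Descartes' rule allows up
to four sign variations on this sector.  Located (seat tools, memo §4): exactly two in every sampled instance.  This is the «monotone-piece»
mechanism of the memo in the one case where the piece structure is global; the general `5 × 5` design (mixed monotonicity) is NOT covered.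
Nothing here bears on `WeakLifting` / `TropicalB` (stmt-19771) in their windows, on Conjecture B, on the Door-A registers, on `MatrixDescartes`
(stmt-ValiantsHypothesis-18050) or on VP ≠ VNP; α status NO MOVER.

WHAT IS PROVED (continuant currency `D_k = pathDet a d b f k`, definite `0 < a`, irreducible `b ≠ 0`, `x > 0`).
* `binom_neg_of_nonpos`, `binom_pos_of_nonneg` — sign monotonicity of a binomial `α z^m − β z^{m+k}` (`α, β > 0`, `k ≥ 1`) along `0 < z < w`;
  `eval_pathDet_two'`, `eval_pathDet_shift_three_two` — the two end `2 × 2` minors as such binomials.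
* `cross_lt` — the algebraic comparison behind the monotonicity of one Schur summand: for `0 < x < y`, `s + q ≤ p ≤ s + r`, `q < r`:
  `x^p · (y^s (α y^q − β y^r)) < y^p · (x^s (α x^q − β x^r))`.
* **`five_edgeMonotone_piece`** — on the sector, two distinct positive zeros of `D₅` at which `D₂` has the same strict sign AND `Δ` has the same
  strict sign do not exist (one zero per monotonicity piece).
* **`five_edgeMonotone_terminal`** — on the sector, a positive zero of `D₅` that is not in the both-positive region (`D₂ > 0 ∧ Δ > 0`) is the
  LAST positive zero.
* **`five_edgeMonotone_card_le_two`** — on the sector, `card posRoots(D₅) ≤ 2`.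
[this seat's `m = 5` analysis; folklore: continuants]
-/

-- `Summit.ValiantsHypothesis.ValiantsHypothesis.…` repeats a component by the D-0017 layout (single-conjunct summit); the name is mandated.
set_option linter.dupNamespace false
set_option autoImplicit false

namespace Summit.ValiantsHypothesis.ValiantsHypothesis.Theorems.KPlusLogSqLaw

namespace StaticTridiagonalRealOverlap

open Polynomial
open Summit.ValiantsHypothesis.ValiantsHypothesis.Theorems.KPlusLogSqLaw.StaticTridiagonalRealPotential
  (pathDet pathDet_zero pathDet_one pathDet_add_two pathDet_two eval_ne_zero_of_eval_add_two_eq_zero)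

variable (a : ℕ → ℝ) (d : ℕ → ℕ) (b : ℕ → ℝ) (f : ℕ → ℕ)

/-! ### §1 Binomials and the two end minors -/

/-- A binomial `α z^m − β z^{m+k}` (`α, β > 0`, `k ≥ 1`) that is `≤ 0` at `z > 0` is `< 0` at every `w > z`. -/
theorem binom_neg_of_nonpos {α β z w : ℝ} {m k : ℕ} (hβ : 0 < β) (hk : k ≠ 0) (hz : 0 < z) (hzw : z < w)
    (h : α * z ^ m - β * z ^ (m + k) ≤ 0) : α * w ^ m - β * w ^ (m + k) < 0 := by
  have hw : 0 < w := hz.trans hzw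
  have hzm : 0 < z ^ m := pow_pos hz m
  have hwm : 0 < w ^ m := pow_pos hw m
  have hzk : z ^ k < w ^ k := pow_lt_pow_left₀ hzw hz.le hk
  rw [pow_add] at h ⊢
  -- `α ≤ β z^k`
  have h1 : α ≤ β * z ^ k := by
    by_contra hc
    push Not at hc
    have : 0 < z ^ m * (α - β * z ^ k) := mul_pos hzm (by linarith)
    nlinarith
  have h2 : α < β * w ^ k := lt_of_le_of_lt h1 (by nlinarith)
  nlinarith [mul_lt_mul_of_pos_right h2 hwm]

/-- A binomial `α w^m − β w^{m+k}` (`α, β > 0`, `k ≥ 1`) that is `≥ 0` at `w` is `> 0` at every `0 < z < w`. -/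
theorem binom_pos_of_nonneg {α β z w : ℝ} {m k : ℕ} (hβ : 0 < β) (hk : k ≠ 0) (hz : 0 < z) (hzw : z < w)
    (h : 0 ≤ α * w ^ m - β * w ^ (m + k)) : 0 < α * z ^ m - β * z ^ (m + k) := by
  by_contra hc
  push Not at hc
  have := binom_neg_of_nonpos hβ hk hz hzw hc
  linarith

/-- `D₂(z) = a₁a₀ z^{d₁+d₀} − b₀² z^{2f₀}`. -/
theorem eval_pathDet_two' (z : ℝ) :
    (pathDet a d b f 2).eval z = a 1 * a 0 * z ^ (d 1 + d 0) - b 0 ^ 2 * z ^ (2 * f 0) := by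
  rw [pathDet_two]; simp only [eval_add, eval_mul, eval_C, eval_pow, eval_X]; ring

/-- `Δ(z) = D⁽³⁾₂(z) = a₄a₃ z^{d₄+d₃} − b₃² z^{2f₃}` (the trailing `2 × 2` minor). -/
theorem eval_pathDet_shift_three_two (z : ℝ) :
    (pathDet (fun t => a (t + 3)) (fun t => d (t + 3)) (fun t => b (t + 3)) (fun t => f (t + 3)) 2).eval z =
      a 4 * a 3 * z ^ (d 4 + d 3) - b 3 ^ 2 * z ^ (2 * f 3) := by
  rw [pathDet_two]; simp only [eval_add, eval_mul, eval_C, eval_pow, eval_X, Nat.reduceAdd]; ring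

/-! ### §2 The algebraic comparison and the piece law -/

/-- **The cross comparison.**  For `0 < x < y`, `α, β > 0` and exponents with `s + q ≤ p ≤ s + r`, `q < r`:
`x^p · (y^s (α y^q − β y^r)) < y^p · (x^s (α x^q − β x^r))`.  (With `p = 2f₁ + d₀`, `s = d₂`, `q = d₁ + d₀`, `r = 2f₀`, `α = a₁a₀`, `β = b₀²`
this is the numerator of `φ(x) < φ(y)` for the Schur summand `φ = b₁²a₀x^{2f₁+d₀}/(a₂x^{d₂}D₂)`.) -/
theorem cross_lt {α β x y : ℝ} {p q r s : ℕ} (hα : 0 < α) (hβ : 0 < β) (hx : 0 < x) (hxy : x < y)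
    (hq : s + q ≤ p) (hr : p ≤ s + r) (hqr : q < r) :
    x ^ p * (y ^ s * (α * y ^ q - β * y ^ r)) < y ^ p * (x ^ s * (α * x ^ q - β * x ^ r)) := by
  have hy : 0 < y := hx.trans hxy
  obtain ⟨k, hk⟩ := Nat.exists_eq_add_of_le hq
  obtain ⟨k', hk'⟩ := Nat.exists_eq_add_of_le hr
  have hkk : k + k' ≠ 0 := by omega
  subst hk
  have hr' : r = q + k + k' := by omega
  subst hr'
  -- the difference is `α (xy)^{s+q} (x^k − y^k) − β (xy)^{s+q+k} (y^{k'} − x^{k'})`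
  have e : x ^ (s + q + k) * (y ^ s * (α * y ^ q - β * y ^ (q + k + k'))) -
      y ^ (s + q + k) * (x ^ s * (α * x ^ q - β * x ^ (q + k + k'))) =
      α * ((x * y) ^ (s + q) * (x ^ k - y ^ k)) - β * ((x * y) ^ (s + q + k) * (y ^ k' - x ^ k')) := by
    simp only [pow_add, mul_pow]; ring
  rw [← sub_neg, e]
  have hxyk : x ^ k ≤ y ^ k := pow_le_pow_left₀ hx.le hxy.le k
  have hxyk' : x ^ k' ≤ y ^ k' := pow_le_pow_left₀ hx.le hxy.le k'
  have hP1 : 0 < (x * y) ^ (s + q) := pow_pos (mul_pos hx hy) _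
  have hP2 : 0 < (x * y) ^ (s + q + k) := pow_pos (mul_pos hx hy) _
  have t1 : (x * y) ^ (s + q) * (x ^ k - y ^ k) ≤ 0 := mul_nonpos_of_nonneg_of_nonpos hP1.le (by linarith)
  have t2 : 0 ≤ (x * y) ^ (s + q + k) * (y ^ k' - x ^ k') := mul_nonneg hP2.le (by linarith)
  rcases Nat.eq_zero_or_pos k with hk0 | hkpos
  · -- `k = 0`, so `k' ≥ 1`: the second term is strictly positive
    subst hk0
    have hk'0 : k' ≠ 0 := by simpa using hkk
    have hlt : x ^ k' < y ^ k' := pow_lt_pow_left₀ hxy hx.le hk'0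
    have t2' : 0 < (x * y) ^ (s + q + 0) * (y ^ k' - x ^ k') := mul_pos hP2 (by linarith)
    nlinarith
  · have hlt : x ^ k < y ^ k := pow_lt_pow_left₀ hxy hx.le hkpos.ne'
    have t1' : (x * y) ^ (s + q) * (x ^ k - y ^ k) < 0 := mul_neg_of_pos_of_neg hP1 (by linarith)
    nlinarith

/-- Division comparison from a cross inequality when the denominators have the same sign. [bookkeeping] -/
theorem div_lt_div_of_cross {u v u' v' : ℝ} (hvv : 0 < v * v') (h : u * v' < u' * v) : u / v < u' / v' := by
  have hv : v ≠ 0 := fun h0 => by rw [h0, zero_mul] at hvv; exact lt_irrefl _ hvv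
  have hv' : v' ≠ 0 := fun h0 => by rw [h0, mul_zero] at hvv; exact lt_irrefl _ hvv
  rw [← sub_neg, div_sub_div _ _ hv hv']
  exact div_neg_of_neg_of_pos (by linarith) hvv

/-- **THE PIECE LAW on the edge-monotone sector.**  Hypotheses `h1 … h6` are `0 < σ₁`, `0 ≤ σ₂`, `σ₂ ≤ σ₁`, `0 < σ₄`, `0 ≤ σ₃`, `σ₃ ≤ σ₄` in the
exponents.  Then two positive zeros `x < y` of `D₅` at which the leading `2 × 2` minor `D₂` has the same strict sign and the trailing `2 × 2`
minor `Δ` has the same strict sign cannot exist: on such a piece both Schur summands `φ = b₁²a₀x^{2f₁+d₀}/(a₂x^{d₂}D₂)` and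
`ψ = b₂²a₄x^{2f₂+d₄}/(a₂x^{d₂}Δ)` strictly increase while `φ + ψ = 1` at every zero (Part 2's vertex expansion). -/
theorem five_edgeMonotone_piece (ha : ∀ t, 0 < a t) (hb : ∀ t, b t ≠ 0)
    (h1 : d 1 + d 0 < 2 * f 0) (h2 : d 2 + (d 1 + d 0) ≤ 2 * f 1 + d 0) (h3 : 2 * f 1 + d 0 ≤ d 2 + 2 * f 0)
    (h4 : d 4 + d 3 < 2 * f 3) (h5 : d 2 + (d 4 + d 3) ≤ 2 * f 2 + d 4) (h6 : 2 * f 2 + d 4 ≤ d 2 + 2 * f 3)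
    {x y : ℝ} (hx : 0 < x) (hxy : x < y)
    (hrx : (pathDet a d b f 5).eval x = 0) (hry : (pathDet a d b f 5).eval y = 0)
    (hD2 : 0 < (pathDet a d b f 2).eval x * (pathDet a d b f 2).eval y)
    (hΔ : 0 < (pathDet (fun t => a (t + 3)) (fun t => d (t + 3)) (fun t => b (t + 3)) (fun t => f (t + 3)) 2).eval x *
      (pathDet (fun t => a (t + 3)) (fun t => d (t + 3)) (fun t => b (t + 3)) (fun t => f (t + 3)) 2).eval y) : False := by
  have hy : 0 < y := hx.trans hxy
  set D2x := (pathDet a d b f 2).eval x with hD2x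
  set D2y := (pathDet a d b f 2).eval y with hD2y
  set Δx := (pathDet (fun t => a (t + 3)) (fun t => d (t + 3)) (fun t => b (t + 3)) (fun t => f (t + 3)) 2).eval x with hΔx
  set Δy := (pathDet (fun t => a (t + 3)) (fun t => d (t + 3)) (fun t => b (t + 3)) (fun t => f (t + 3)) 2).eval y with hΔy
  have hD2x0 : D2x ≠ 0 := fun h => by rw [h, zero_mul] at hD2; exact lt_irrefl _ hD2
  have hD2y0 : D2y ≠ 0 := fun h => by rw [h, mul_zero] at hD2; exact lt_irrefl _ hD2
  have hΔx0 : Δx ≠ 0 := fun h => by rw [h, zero_mul] at hΔ; exact lt_irrefl _ hΔ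
  have hΔy0 : Δy ≠ 0 := fun h => by rw [h, mul_zero] at hΔ; exact lt_irrefl _ hΔ
  have hMx : 0 < a 2 * x ^ d 2 := mul_pos (ha 2) (pow_pos hx _)
  have hMy : 0 < a 2 * y ^ d 2 := mul_pos (ha 2) (pow_pos hy _)
  -- the Schur form: `φ + ψ = 1` at both zeros
  have vx := five_eval_vertex a d b f x
  have vy := five_eval_vertex a d b f y
  rw [hrx] at vx
  rw [hry] at vy
  have ex : (b 1 * x ^ f 1) ^ 2 * (a 0 * x ^ d 0) / (a 2 * x ^ d 2 * D2x) +
      (b 2 * x ^ f 2) ^ 2 * (a 4 * x ^ d 4) / (a 2 * x ^ d 2 * Δx) = 1 := by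
    rw [div_add_div _ _ (mul_ne_zero hMx.ne' hD2x0) (mul_ne_zero hMx.ne' hΔx0), div_eq_one_iff_eq
      (mul_ne_zero (mul_ne_zero hMx.ne' hD2x0) (mul_ne_zero hMx.ne' hΔx0))]
    linear_combination (a 2 * x ^ d 2) * vx
  have ey : (b 1 * y ^ f 1) ^ 2 * (a 0 * y ^ d 0) / (a 2 * y ^ d 2 * D2y) +
      (b 2 * y ^ f 2) ^ 2 * (a 4 * y ^ d 4) / (a 2 * y ^ d 2 * Δy) = 1 := by
    rw [div_add_div _ _ (mul_ne_zero hMy.ne' hD2y0) (mul_ne_zero hMy.ne' hΔy0), div_eq_one_iff_eq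
      (mul_ne_zero (mul_ne_zero hMy.ne' hD2y0) (mul_ne_zero hMy.ne' hΔy0))]
    linear_combination (a 2 * y ^ d 2) * vy
  -- `φ(x) < φ(y)`
  have hφ : (b 1 * x ^ f 1) ^ 2 * (a 0 * x ^ d 0) / (a 2 * x ^ d 2 * D2x) <
      (b 1 * y ^ f 1) ^ 2 * (a 0 * y ^ d 0) / (a 2 * y ^ d 2 * D2y) := by
    refine div_lt_div_of_cross (by nlinarith [mul_pos hMx hMy]) ?_
    have key := cross_lt (α := a 1 * a 0) (β := b 0 ^ 2) (s := d 2) (mul_pos (ha 1) (ha 0)) (by have := hb 0; positivity)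
      hx hxy h2 h3 h1
    rw [hD2x, hD2y, eval_pathDet_two', eval_pathDet_two']
    have hc : 0 < b 1 ^ 2 * a 0 * a 2 := by have := hb 1; have := ha 0; have := ha 2; positivity
    have e : (b 1 * x ^ f 1) ^ 2 * (a 0 * x ^ d 0) * (a 2 * y ^ d 2 * (a 1 * a 0 * y ^ (d 1 + d 0) - b 0 ^ 2 * y ^ (2 * f 0))) -
        (b 1 * y ^ f 1) ^ 2 * (a 0 * y ^ d 0) * (a 2 * x ^ d 2 * (a 1 * a 0 * x ^ (d 1 + d 0) - b 0 ^ 2 * x ^ (2 * f 0))) =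
        (b 1 ^ 2 * a 0 * a 2) * (x ^ (2 * f 1 + d 0) * (y ^ d 2 * (a 1 * a 0 * y ^ (d 1 + d 0) - b 0 ^ 2 * y ^ (2 * f 0))) -
          y ^ (2 * f 1 + d 0) * (x ^ d 2 * (a 1 * a 0 * x ^ (d 1 + d 0) - b 0 ^ 2 * x ^ (2 * f 0)))) := by ring
    rw [← sub_neg, e]
    exact mul_neg_of_pos_of_neg hc (by linarith)
  -- `ψ(x) < ψ(y)`
  have hψ : (b 2 * x ^ f 2) ^ 2 * (a 4 * x ^ d 4) / (a 2 * x ^ d 2 * Δx) <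
      (b 2 * y ^ f 2) ^ 2 * (a 4 * y ^ d 4) / (a 2 * y ^ d 2 * Δy) := by
    refine div_lt_div_of_cross (by nlinarith [mul_pos hMx hMy]) ?_
    have key := cross_lt (α := a 4 * a 3) (β := b 3 ^ 2) (s := d 2) (mul_pos (ha 4) (ha 3)) (by have := hb 3; positivity)
      hx hxy h5 h6 h4
    rw [hΔx, hΔy, eval_pathDet_shift_three_two, eval_pathDet_shift_three_two]
    have hc : 0 < b 2 ^ 2 * a 4 * a 2 := by have := hb 2; have := ha 4; have := ha 2; positivity
    have e : (b 2 * x ^ f 2) ^ 2 * (a 4 * x ^ d 4) * (a 2 * y ^ d 2 * (a 4 * a 3 * y ^ (d 4 + d 3) - b 3 ^ 2 * y ^ (2 * f 3))) -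
        (b 2 * y ^ f 2) ^ 2 * (a 4 * y ^ d 4) * (a 2 * x ^ d 2 * (a 4 * a 3 * x ^ (d 4 + d 3) - b 3 ^ 2 * x ^ (2 * f 3))) =
        (b 2 ^ 2 * a 4 * a 2) * (x ^ (2 * f 2 + d 4) * (y ^ d 2 * (a 4 * a 3 * y ^ (d 4 + d 3) - b 3 ^ 2 * y ^ (2 * f 3))) -
          y ^ (2 * f 2 + d 4) * (x ^ d 2 * (a 4 * a 3 * x ^ (d 4 + d 3) - b 3 ^ 2 * x ^ (2 * f 3)))) := by ring
    rw [← sub_neg, e]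
    exact mul_neg_of_pos_of_neg hc (by linarith)
  linarith

/-! ### §3 Counting: at most two positive zeros on the edge-monotone sector -/

/-- **TERMINAL LAW on the edge-monotone sector.**  A positive zero `x` of `D₅` which is NOT in the both-positive region
(`¬(0 < D₂(x) ∧ 0 < Δ(x))`, i.e. a class-one zero by Part 2) is the last positive zero: no zero `y > x` exists. -/
theorem five_edgeMonotone_terminal (ha : ∀ t, 0 < a t) (hb : ∀ t, b t ≠ 0)
    (h1 : d 1 + d 0 < 2 * f 0) (h2 : d 2 + (d 1 + d 0) ≤ 2 * f 1 + d 0) (h3 : 2 * f 1 + d 0 ≤ d 2 + 2 * f 0)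
    (h4 : d 4 + d 3 < 2 * f 3) (h5 : d 2 + (d 4 + d 3) ≤ 2 * f 2 + d 4) (h6 : 2 * f 2 + d 4 ≤ d 2 + 2 * f 3)
    {x y : ℝ} (hx : 0 < x) (hxy : x < y)
    (hrx : (pathDet a d b f 5).eval x = 0) (hry : (pathDet a d b f 5).eval y = 0)
    (hcls : ¬ (0 < (pathDet a d b f 2).eval x ∧
      0 < (pathDet (fun t => a (t + 3)) (fun t => d (t + 3)) (fun t => b (t + 3)) (fun t => f (t + 3)) 2).eval x)) : False := by
  have hy : 0 < y := hx.trans hxy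
  -- exponent bookkeeping for the two binomials
  obtain ⟨k, hk⟩ := Nat.exists_eq_add_of_le h1.le
  obtain ⟨k', hk'⟩ := Nat.exists_eq_add_of_le h4.le
  have hk0 : k ≠ 0 := by omega
  have hk0' : k' ≠ 0 := by omega
  have e2 : ∀ z : ℝ, (pathDet a d b f 2).eval z = (a 1 * a 0) * z ^ (d 1 + d 0) - b 0 ^ 2 * z ^ ((d 1 + d 0) + k) := by
    intro z; rw [eval_pathDet_two', hk]
  have eΔ : ∀ z : ℝ, (pathDet (fun t => a (t + 3)) (fun t => d (t + 3)) (fun t => b (t + 3)) (fun t => f (t + 3)) 2).eval z =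
      (a 4 * a 3) * z ^ (d 4 + d 3) - b 3 ^ 2 * z ^ ((d 4 + d 3) + k') := by
    intro z; rw [eval_pathDet_shift_three_two, hk']
  have hβ : 0 < b 0 ^ 2 := by have := hb 0; positivity
  have hβ' : 0 < b 3 ^ 2 := by have := hb 3; positivity
  set D2x := (pathDet a d b f 2).eval x with hD2x
  set D2y := (pathDet a d b f 2).eval y with hD2y
  set Δx := (pathDet (fun t => a (t + 3)) (fun t => d (t + 3)) (fun t => b (t + 3)) (fun t => f (t + 3)) 2).eval x with hΔx
  set Δy := (pathDet (fun t => a (t + 3)) (fun t => d (t + 3)) (fun t => b (t + 3)) (fun t => f (t + 3)) 2).eval y with hΔy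
  -- sign monotonicity of `D₂` and `Δ` from `x` to `y`
  have mD2 : D2x ≤ 0 → D2y < 0 := fun h => by
    rw [hD2y, e2]; exact binom_neg_of_nonpos hβ hk0 hx hxy (by rw [hD2x, e2] at h; exact h)
  have mD2' : 0 ≤ D2y → 0 < D2x := fun h => by
    rw [hD2x, e2]; exact binom_pos_of_nonneg hβ hk0 hx hxy (by rw [hD2y, e2] at h; exact h)
  have mΔ : Δx ≤ 0 → Δy < 0 := fun h => by
    rw [hΔy, eΔ]; exact binom_neg_of_nonpos hβ' hk0' hx hxy (by rw [hΔx, eΔ] at h; exact h)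
  have mΔ' : 0 ≤ Δy → 0 < Δx := fun h => by
    rw [hΔx, eΔ]; exact binom_pos_of_nonneg hβ' hk0' hx hxy (by rw [hΔy, eΔ] at h; exact h)
  have poley := five_pole_law a d b f ha hb hy hry
  have polex := five_pole_law a d b f ha hb hx hrx
  have nny := five_not_both_end_minors_neg a d b f ha hb hy hry
  have piece := five_edgeMonotone_piece a d b f ha hb h1 h2 h3 h4 h5 h6 hx hxy hrx hry
  -- case analysis on the signs at `x`
  rcases lt_trichotomy D2x 0 with hx2 | hx2 | hx2
  · -- `D₂(x) < 0`: then `D₂(y) < 0`; `Δ(y)` cannot be `< 0` (both negative), `= 0` (pole law), so `Δ(y) > 0`, hence `Δ(x) > 0`: same piece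
    have hy2 : D2y < 0 := mD2 hx2.le
    rcases lt_trichotomy Δy 0 with hyΔ | hyΔ | hyΔ
    · exact nny ⟨hy2, hyΔ⟩
    · exact absurd (poley.2 hyΔ) hy2.ne
    · exact piece (mul_pos_of_neg_of_neg hx2 hy2) (mul_pos (mΔ' hyΔ.le) hyΔ)
  · -- `D₂(x) = 0`: double pole at `x`; then both minors are negative at `y`
    have hxΔ : Δx = 0 := polex.1 hx2
    exact nny ⟨mD2 hx2.le, mΔ hxΔ.le⟩
  · -- `D₂(x) > 0`, so `Δ(x) ≤ 0` by `hcls`; `Δ(x) = 0` contradicts the pole law, so `Δ(x) < 0` and `Δ(y) < 0`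
    have hxΔ : Δx < 0 := by
      rcases lt_trichotomy Δx 0 with h | h | h
      · exact h
      · exact absurd (polex.2 h) hx2.ne'
      · exact absurd ⟨hx2, h⟩ hcls
    have hyΔ : Δy < 0 := mΔ hxΔ.le
    rcases lt_trichotomy D2y 0 with hy2 | hy2 | hy2
    · exact nny ⟨hy2, hyΔ⟩
    · exact absurd (poley.1 hy2) hyΔ.ne
    · exact piece (mul_pos hx2 hy2) (mul_pos_of_neg_of_neg hxΔ hyΔ)

/-- Three increasing positive zeros are impossible on the edge-monotone sector. -/
theorem five_edgeMonotone_no_three (ha : ∀ t, 0 < a t) (hb : ∀ t, b t ≠ 0)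
    (h1 : d 1 + d 0 < 2 * f 0) (h2 : d 2 + (d 1 + d 0) ≤ 2 * f 1 + d 0) (h3 : 2 * f 1 + d 0 ≤ d 2 + 2 * f 0)
    (h4 : d 4 + d 3 < 2 * f 3) (h5 : d 2 + (d 4 + d 3) ≤ 2 * f 2 + d 4) (h6 : 2 * f 2 + d 4 ≤ d 2 + 2 * f 3)
    {x y z : ℝ} (hx : 0 < x) (hxy : x < y) (hyz : y < z)
    (hrx : (pathDet a d b f 5).eval x = 0) (hry : (pathDet a d b f 5).eval y = 0) (hrz : (pathDet a d b f 5).eval z = 0) :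
    False := by
  have hy : 0 < y := hx.trans hxy
  by_cases hcx : 0 < (pathDet a d b f 2).eval x ∧
      0 < (pathDet (fun t => a (t + 3)) (fun t => d (t + 3)) (fun t => b (t + 3)) (fun t => f (t + 3)) 2).eval x
  · by_cases hcy : 0 < (pathDet a d b f 2).eval y ∧
        0 < (pathDet (fun t => a (t + 3)) (fun t => d (t + 3)) (fun t => b (t + 3)) (fun t => f (t + 3)) 2).eval y
    · exact five_edgeMonotone_piece a d b f ha hb h1 h2 h3 h4 h5 h6 hx hxy hrx hry (mul_pos hcx.1 hcy.1) (mul_pos hcx.2 hcy.2)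
    · exact five_edgeMonotone_terminal a d b f ha hb h1 h2 h3 h4 h5 h6 hy hyz hry hrz hcy
  · exact five_edgeMonotone_terminal a d b f ha hb h1 h2 h3 h4 h5 h6 hx hxy hrx hry hcx

/-- **THE EDGE-MONOTONE `5 × 5` LAW: at most TWO positive determinant zeros** for a definite irreducible `5 × 5` static symmetric
tridiagonal monomial design whose exponents satisfy `0 < σ₁`, `0 ≤ σ₂ ≤ σ₁`, `0 ≤ σ₃ ≤ σ₄`, `0 < σ₄` (`σ₁ = 2f₀ − d₀ − d₁`, `σ₂ = 2f₁ − d₁ − d₂`,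
`σ₃ = 2f₂ − d₂ − d₃`, `σ₄ = 2f₃ − d₃ − d₄`).  Descartes' rule allows up to four sign variations here. [this seat] -/
theorem five_edgeMonotone_card_le_two (ha : ∀ t, 0 < a t) (hb : ∀ t, b t ≠ 0)
    (h1 : d 1 + d 0 < 2 * f 0) (h2 : d 2 + (d 1 + d 0) ≤ 2 * f 1 + d 0) (h3 : 2 * f 1 + d 0 ≤ d 2 + 2 * f 0)
    (h4 : d 4 + d 3 < 2 * f 3) (h5 : d 2 + (d 4 + d 3) ≤ 2 * f 2 + d 4) (h6 : 2 * f 2 + d 4 ≤ d 2 + 2 * f 3) :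
    ((pathDet a d b f 5).roots.toFinset.filter (fun x => 0 < x)).card ≤ 2 := by
  classical
  by_contra hgt
  push Not at hgt
  obtain ⟨u, hu, v, hv, w, hw, huv, huw, hvw⟩ := Finset.two_lt_card.1 hgt
  simp only [Finset.mem_filter, Multiset.mem_toFinset] at hu hv hw
  have ru : (pathDet a d b f 5).eval u = 0 := (mem_roots'.1 hu.1).2
  have rv : (pathDet a d b f 5).eval v = 0 := (mem_roots'.1 hv.1).2
  have rw' : (pathDet a d b f 5).eval w = 0 := (mem_roots'.1 hw.1).2
  have N := fun {x y z : ℝ} (hx : 0 < x) (hxy : x < y) (hyz : y < z) (hrx : (pathDet a d b f 5).eval x = 0)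
    (hry : (pathDet a d b f 5).eval y = 0) (hrz : (pathDet a d b f 5).eval z = 0) =>
    five_edgeMonotone_no_three a d b f ha hb h1 h2 h3 h4 h5 h6 hx hxy hyz hrx hry hrz
  -- order the three roots
  rcases lt_or_gt_of_ne huv with h12 | h12
  · rcases lt_or_gt_of_ne hvw with h23 | h23
    · exact N hu.2 h12 h23 ru rv rw'
    · rcases lt_or_gt_of_ne huw with h13 | h13
      · exact N hu.2 h13 h23 ru rw' rv
      · exact N hw.2 h13 h12 rw' ru rv
  · rcases lt_or_gt_of_ne hvw with h23 | h23
    · rcases lt_or_gt_of_ne huw with h13 | h13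
      · exact N hv.2 h12 h13 rv ru rw'
      · exact N hv.2 h23 h13 rv rw' ru
    · exact N hw.2 h23 h12 rw' rv ru

end StaticTridiagonalRealOverlap

end Summit.ValiantsHypothesis.ValiantsHypothesis.Theorems.KPlusLogSqLaw
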